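import Literature.NumberTheory.EllipticCurves.IsogenyTwoTorsionProofs
import Literature.NumberTheory.EllipticCurves.IsogenyVariableChangeProofs
import Literature.NumberTheory.EllipticCurves.IsogenyCompProofs
import Literature.NumberTheory.EllipticCurves.IsogenyMulProofs
import Literature.NumberTheory.EllipticCurves.DeuringSplitOrdinaryProofs
import HarnessLib

/-!
# Deuring's theorem for `j = 8000`: `√-2` on `y² = x³ + 4x² + 2x` modulo `p`

Topic `NumberTheory/EllipticCurves` (trunk T-ELLARITH, notion `cm_endomorphisms_isogeny`).
Companion of `DeuringSplitOrdinaryCertProofs` for the one maximal-order CM discriminant,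
`d = -8` (`j = 8000`, CM by `ℤ[√-2]`), whose CM endomorphism of least degree, `[√-2]`, has even
degree `2` and a `2`-torsion point in its kernel, so that it is not of the shape `U/h²` of the
tree's isogeny formulae. Here `[√-2]` is written down **directly over `𝔽_p`** on
`E : y² = x³ + 4x² + 2x` as the tree's explicit `2`-isogeny `φ : E → E₂ : Y² = X³ - 8X² + 8X`
with kernel `T = (0, 0)` (`WeierstrassCurve.twoIsogeny`, Silverman *AEC* III.4.5) followed by the
isomorphism `E₂ ⥲ E`, `(X, Y) ↦ (X/s², Y/s³)`, `s² = -2 ∈ 𝔽_p` (a change of variables,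
`VariableChange.toIsogeny`), available exactly when `-2` is a square mod `p`:

* `sqrtNegTwo s hs : Isogeny (curve p) (curve p)` and
  `sqrtNegTwo_comp_self : [√-2] ([√-2] P) = (-2) • P` — checked on affine points off `E[2]` by
  the duplication formula (two rational identities in `x`, `ring` after `y² = x³ + 4x² + 2x`),
  and extended to all points since both sides are homomorphisms agreeing off a finite set;
* `exists_ne_zero_nsmul_eq_zero` — for an odd prime `p` with `(-2/p) = 1`, `E mod p` has a point
  of order `p` over `\overline{𝔽_p}` (`Isogeny.exists_ne_zero_nsmul_eq_zero_of_comp_self_eq_smul`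
  of `DeuringSplitOrdinaryProofs` with `ψ = [√-2]`, `d = -2`): Lang, *Elliptic Functions*,
  Ch. 13 §4 Thm. 12, split case, for this curve.

## References

* [Lang1987] S. Lang, *Elliptic Functions*, 2nd ed., Ch. 13 §4 Thm. 12.
* [SilvermanAEC2009] *AEC*, III.4 Example 4.5 (the `2`-isogeny), III.2.3 (duplication).
* [SilvermanAdvancedTopics1994] *AT*, II, Prop. 2.3.1(ii) (`[√-2]` on `y² = x³ + 4x² + 2x`).

## Design

Theorems and two definitions-with-body (`twistChange`, `sqrtNegTwo`); `open scoped Classical`.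
-/

noncomputable section

open scoped Classical

open WeierstrassCurve

universe u

namespace WeierstrassCurve.Isogeny

variable {K : Type u} [Field K] {W W₁ W₂ : WeierstrassCurve K}

/-- Transport of the codomain of an isogeny along an equality of Weierstrass equations.
[folklore] -/
def congrRight (h : W₁ = W₂) (φ : Isogeny W W₁) : Isogeny W W₂ := h ▸ φ

/-- `congrRight` acts through `Affine.Point.congrEquiv` on geometric points. [folklore] -/
theorem congrRight_apply (h : W₁ = W₂) (φ : Isogeny W W₁) (P : W.geomPoints) :
    φ.congrRight h P =
      Affine.Point.congrEquiv (congrArg (fun V : WeierstrassCurve K ↦ V.baseChange (AlgebraicClosure K)) h)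
        (φ P) := by
  subst h; rfl

end WeierstrassCurve.Isogeny

namespace Literature.NumberTheory.EllipticCurves

namespace DeuringSqrtTwo

/-! ## The algebra: two rational identities -/

section Algebra

variable {F : Type*} [Field F]

/-- `x ≠ 0` and `x² + 4x + 2 ≠ 0` for a point `(x, y)`, `y ≠ 0`, of `y² = x³ + 4x² + 2x`.
[folklore] -/
theorem x_ne_zero_and {x y : F} (hcurve : y ^ 2 = x ^ 3 + 4 * x ^ 2 + 2 * x) (hy : y ≠ 0) :
    x ≠ 0 ∧ x ^ 2 + 4 * x + 2 ≠ 0 := by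
  have h : y ^ 2 = x * (x ^ 2 + 4 * x + 2) := by rw [hcurve]; ring
  constructor
  · rintro rfl
    exact hy (pow_eq_zero_iff two_ne_zero |>.mp (by rw [h, zero_mul]))
  · intro hq
    exact hy (pow_eq_zero_iff two_ne_zero |>.mp (by rw [h, hq, mul_zero]))

/-- **The `x`-identity** `x([√-2]² P) = x(2P)`: with `x₁ = -(x² + 4x + 2)/(2x)`,
`-(x₁² + 4x₁ + 2)/(2x₁) = ℓ² - 4 - 2x`, `ℓ = (3x² + 8x + 2)/(2y)` the tangent slope.
[cite: SilvermanAEC2009, III.2.3(d)] -/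
theorem x_identity {x y : F} (h2 : (2 : F) ≠ 0) (hcurve : y ^ 2 = x ^ 3 + 4 * x ^ 2 + 2 * x)
    (hy : y ≠ 0) :
    -(((-((x ^ 2 + 4 * x + 2) / x) / 2) ^ 2 + 4 * (-((x ^ 2 + 4 * x + 2) / x) / 2) + 2) /
        (-((x ^ 2 + 4 * x + 2) / x) / 2)) / 2 =
      ((3 * x ^ 2 + 2 * 4 * x + 2) / (2 * y)) ^ 2 - 4 - x - x := by
  obtain ⟨hx, hq⟩ := x_ne_zero_and hcurve hy
  set q := x ^ 2 + 4 * x + 2 with hqx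
  have hy2 : (2 * y) ^ 2 = 4 * (x * q) := by rw [mul_pow, hcurve, hqx]; ring
  rw [div_pow (3 * x ^ 2 + 2 * 4 * x + 2) (2 * y), hy2]
  have h4 : (4 : F) ≠ 0 := by
    have : (4 : F) = 2 * 2 := by norm_num
    rw [this]; exact mul_ne_zero h2 h2
  field_simp
  rw [hqx]
  ring

/-- **The `y`-identity** `y([√-2]² P) = y(-2P)`: with `x₁` as above, `Y = y(x² - 2)/x²`,
`-(Y(x₁² - 2)/x₁²)/8 = ℓ(x(2P) - x) + y`. [cite: SilvermanAEC2009, III.2.3(d)] -/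
theorem y_identity {x y : F} (h2 : (2 : F) ≠ 0) (hcurve : y ^ 2 = x ^ 3 + 4 * x ^ 2 + 2 * x)
    (hy : y ≠ 0) :
    -(y * (x ^ 2 - 2) / x ^ 2 * ((-((x ^ 2 + 4 * x + 2) / x) / 2) ^ 2 - 2) /
        (-((x ^ 2 + 4 * x + 2) / x) / 2) ^ 2) / 8 =
      (3 * x ^ 2 + 2 * 4 * x + 2) / (2 * y) *
          (((3 * x ^ 2 + 2 * 4 * x + 2) / (2 * y)) ^ 2 - 4 - x - x - x) + y := by
  obtain ⟨hx, hq⟩ := x_ne_zero_and hcurve hy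
  set q := x ^ 2 + 4 * x + 2 with hqx
  have hyq : y ^ 2 = x * q := by rw [hcurve, hqx]; ring
  have h2y : 2 * y ≠ 0 := mul_ne_zero h2 hy
  have hy2 : (2 * y) ^ 2 = 4 * (x * q) := by rw [mul_pow, hyq]; ring
  rw [div_pow (3 * x ^ 2 + 2 * 4 * x + 2) (2 * y), hy2]
  have h4 : (4 : F) ≠ 0 := by
    have : (4 : F) = 2 * 2 := by norm_num
    rw [this]; exact mul_ne_zero h2 h2
  have h8 : (8 : F) ≠ 0 := by
    have : (8 : F) = 2 * 4 := by norm_num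
    rw [this]; exact mul_ne_zero h2 h4
  -- isolate the odd power of `y` and square it away with `y² = x q`
  rw [← sub_eq_iff_eq_add, div_mul_eq_mul_div (3 * x ^ 2 + 2 * 4 * x + 2) (2 * y), eq_div_iff h2y]
  have e : (-(y * (x ^ 2 - 2) / x ^ 2 * ((-(q / x) / 2) ^ 2 - 2) / (-(q / x) / 2) ^ 2) / 8 - y) *
        (2 * y) =
      2 * y ^ 2 * (-((x ^ 2 - 2) / x ^ 2 * ((-(q / x) / 2) ^ 2 - 2) / (-(q / x) / 2) ^ 2) / 8 - 1) := by
    ring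
  rw [e, hyq]
  field_simp
  rw [hqx]
  ring

end Algebra

/-! ## The curve `y² = x³ + 4x² + 2x` over `𝔽_p` and the isogeny `[√-2]` -/

variable (p : ℕ) [Fact p.Prime]

/-- `E : y² = x³ + 4x² + 2x` over `𝔽_p` (`j = 8000`, CM by `ℤ[√-2]`; Silverman, *AT*,
Prop. II.2.3.1(ii)). [cite: SilvermanAdvancedTopics1994, II Prop. 2.3.1] -/
def curve : WeierstrassCurve (ZMod p) := ⟨0, 4, 0, 2, 0⟩

/-- `E` is in two-torsion normal form (`a₁ = a₃ = a₆ = 0`). [folklore] -/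
instance isTwoTorsionNF_curve : (curve p).IsTwoTorsionNF := ⟨rfl, rfl, rfl⟩

/-- `Δ(E) = 512 = 2⁹`. [folklore] -/
theorem Δ_curve : (curve p).Δ = 512 := by
  simp only [curve, WeierstrassCurve.Δ, WeierstrassCurve.b₂, WeierstrassCurve.b₄,
    WeierstrassCurve.b₆, WeierstrassCurve.b₈]
  norm_num

/-- `c₄(E) = 160`. [folklore] -/
theorem c₄_curve : (curve p).c₄ = 160 := by
  simp only [curve, WeierstrassCurve.c₄, WeierstrassCurve.b₂, WeierstrassCurve.b₄]
  norm_num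

variable {p} (hp2 : p ≠ 2)

include hp2 in
/-- `2 ≠ 0` in `𝔽_p` for `p` odd. [folklore] -/
theorem two_ne_zero_zmod : (2 : ZMod p) ≠ 0 := by
  intro h
  have h' : ((2 : ℕ) : ZMod p) = 0 := by exact_mod_cast h
  rw [ZMod.natCast_eq_zero_iff] at h'
  exact hp2 ((Nat.prime_dvd_prime_iff_eq (Fact.out : p.Prime) Nat.prime_two).mp h')

include hp2 in
/-- `E` has good reduction at odd `p`. [folklore] -/
theorem isElliptic_curve : (curve p).IsElliptic := by
  refine ⟨?_⟩
  rw [Δ_curve, isUnit_iff_ne_zero]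
  have : (512 : ZMod p) = 2 ^ 9 := by norm_num
  rw [this]
  exact pow_ne_zero _ (two_ne_zero_zmod hp2)

include hp2 in
/-- `j(E) = 8000` in `𝔽_p`. [folklore] -/
theorem j_curve : haveI := isElliptic_curve (p := p) hp2; (curve p).j = 8000 := by
  haveI := isElliptic_curve (p := p) hp2
  rw [WeierstrassCurve.j, Units.val_inv_eq_inv_val, WeierstrassCurve.coe_Δ', Δ_curve, c₄_curve]
  have h512 : (512 : ZMod p) ≠ 0 := by
    have : (512 : ZMod p) = 2 ^ 9 := by norm_num
    rw [this]; exact pow_ne_zero _ (two_ne_zero_zmod hp2)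
  rw [inv_mul_eq_iff_eq_mul₀ h512]
  norm_num

/-- The `2`-isogenous curve `E₂ : Y² = X³ - 8X² + 8X`. [cite: SilvermanAEC2009, III.4.5] -/
theorem twoIsogenyCodomain_curve : (curve p).twoIsogenyCodomain = ⟨0, -8, 0, 8, 0⟩ := by
  simp only [WeierstrassCurve.twoIsogenyCodomain, curve]
  ext <;> norm_num

variable (s : ZMod p) (hs : s ^ 2 = -2)

include hs hp2 in
/-- `s ≠ 0`. [folklore] -/
theorem s_ne_zero : s ≠ 0 := fun h ↦ by
  rw [h, zero_pow two_ne_zero, eq_comm, neg_eq_zero] at hs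
  exact two_ne_zero_zmod hp2 hs

/-- The change of variables `(X, Y) ↦ (X/s², Y/s³)`, `u = s`. [folklore] -/
def twistChange : VariableChange (ZMod p) := ⟨Units.mk0 s (s_ne_zero hp2 s hs), 0, 0, 0⟩

include hs in
/-- `E₂` becomes `E` under `u = s`, `s² = -2`. [folklore] -/
theorem twistChange_smul : twistChange hp2 s hs • (curve p).twoIsogenyCodomain = curve p := by
  have hs0 := s_ne_zero hp2 s hs
  have hinv : (s⁻¹) ^ 2 = -2⁻¹ := by rw [inv_pow, hs, inv_neg]
  have hinv4 : (s⁻¹) ^ 4 = 4⁻¹ := by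
    rw [show (4 : ℕ) = 2 * 2 from rfl, pow_mul, hinv, neg_sq, inv_pow]; norm_num
  rw [twoIsogenyCodomain_curve]
  ext
  · simp [twistChange, variableChange_a₁]
  · simp only [twistChange, variableChange_a₂, Units.val_inv_eq_inv_val, Units.val_mk0, hinv, curve]
    have h2 : (2 : ZMod p) ≠ 0 := two_ne_zero_zmod hp2
    field_simp
    norm_num
  · simp [twistChange, variableChange_a₃]
  · simp only [twistChange, variableChange_a₄, Units.val_inv_eq_inv_val, Units.val_mk0, hinv4, curve]
    have h4 : (4 : ZMod p) ≠ 0 := by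
      have : (4 : ZMod p) = 2 ^ 2 := by norm_num
      rw [this]; exact pow_ne_zero _ (two_ne_zero_zmod hp2)
    field_simp
    norm_num
  · simp [twistChange, variableChange_a₆, curve]

/-- **`[√-2] : E → E` over `𝔽_p`**: the `2`-isogeny with kernel `T = (0,0)` followed by
`E₂ ⥲ E`. [cite: SilvermanAdvancedTopics1994, II Prop. 2.3.1] -/
def sqrtNegTwo : Isogeny (curve p) (curve p) :=
  haveI := isElliptic_curve (p := p) hp2
  ((VariableChange.toIsogeny _ (twistChange hp2 s hs)).comp (curve p).twoIsogeny).congrRight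
    (twistChange_smul hp2 s hs)

/-- The curve equation over `\overline{𝔽_p}`. [folklore] -/
theorem curve_rel {x y : (AlgebraicClosure (ZMod p))}
    (h : ((curve p).baseChange (AlgebraicClosure (ZMod p))).toAffine.Nonsingular x y) :
    y ^ 2 = x ^ 3 + 4 * x ^ 2 + 2 * x := by
  have e := (equation_iff_of_isTwoTorsionNF ((curve p).baseChange (AlgebraicClosure (ZMod p))) x y).mp h.left
  have ha₂ : ((curve p).baseChange (AlgebraicClosure (ZMod p))).a₂ = 4 := by
    simp only [WeierstrassCurve.baseChange, WeierstrassCurve.map_a₂, curve, map_ofNat]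
  have ha₄ : ((curve p).baseChange (AlgebraicClosure (ZMod p))).a₄ = 2 := by
    simp only [WeierstrassCurve.baseChange, WeierstrassCurve.map_a₄, curve, map_ofNat]
  rw [ha₂, ha₄] at e
  exact e

include hp2 in
/-- `2 ≠ 0` in `\overline{𝔽_p}`. [folklore] -/
theorem two_ne_zero_bar : (2 : (AlgebraicClosure (ZMod p))) ≠ 0 := by
  rw [← map_ofNat (algebraMap (ZMod p) (AlgebraicClosure (ZMod p))) 2]
  exact (map_ne_zero _).mpr (two_ne_zero_zmod hp2)

/-- **`[√-2]` on an affine point with `x ≠ 0`**: `(x, y) ↦ (-(x² + 4x + 2)/(2x), s̄ y(x² - 2)/(4x²))`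
(`s̄` the image of `s`; `1/s² = -1/2`, `1/s³ = s/4`). [folklore] -/
theorem sqrtNegTwo_some {x y : (AlgebraicClosure (ZMod p))} (h : ((curve p).baseChange (AlgebraicClosure (ZMod p))).toAffine.Nonsingular x y)
    (hx : x ≠ 0) :
    ∃ h', sqrtNegTwo hp2 s hs (.some x y h) =
      .some (-((x ^ 2 + 4 * x + 2) / x) / 2)
        (algebraMap (ZMod p) (AlgebraicClosure (ZMod p)) s / 4 * (y * (x ^ 2 - 2) / x ^ 2)) h' := by
  haveI := isElliptic_curve (p := p) hp2
  set sb := algebraMap (ZMod p) (AlgebraicClosure (ZMod p)) s with hsb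
  have hsb2 : sb ^ 2 = -2 := by rw [hsb, ← map_pow, hs, map_neg, map_ofNat]
  have h2 := two_ne_zero_bar (p := p) hp2
  have hsb0 : sb ≠ 0 := fun h ↦ by rw [h, zero_pow two_ne_zero, eq_comm, neg_eq_zero] at hsb2; exact h2 hsb2
  have hinv2 : sb⁻¹ ^ 2 = -2⁻¹ := by rw [inv_pow, hsb2, inv_neg]
  have hinv3 : sb⁻¹ ^ 3 = sb / 4 := by
    have h4' : sb ^ 4 = 4 := by
      rw [show (4 : ℕ) = 2 * 2 from rfl, pow_mul, hsb2]; norm_num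
    have e : sb⁻¹ ^ 3 = sb⁻¹ ^ 4 * sb := by
      rw [pow_succ sb⁻¹ 3, mul_assoc, inv_mul_cancel₀ hsb0, mul_one]
    rw [e, inv_pow, h4', div_eq_mul_inv, mul_comm]
  obtain ⟨h₁, e₁⟩ := (curve p).twoIsogenyGeomHom_some h hx
  have ha₂ : ((curve p).baseChange (AlgebraicClosure (ZMod p))).a₂ = 4 := by
    simp only [WeierstrassCurve.baseChange, WeierstrassCurve.map_a₂, curve, map_ofNat]
  have ha₄ : ((curve p).baseChange (AlgebraicClosure (ZMod p))).a₄ = 2 := by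
    simp only [WeierstrassCurve.baseChange, WeierstrassCurve.map_a₄, curve, map_ofNat]
  have eX : ((curve p).baseChange (AlgebraicClosure (ZMod p))).twoIsogenyX x = (x ^ 2 + 4 * x + 2) / x := by
    rw [WeierstrassCurve.twoIsogenyX, ha₂, ha₄]
  have eY : ((curve p).baseChange (AlgebraicClosure (ZMod p))).twoIsogenyY x y = y * (x ^ 2 - 2) / x ^ 2 := by
    rw [WeierstrassCurve.twoIsogenyY, ha₄]
  -- apply the change of variables
  have e₂ := VariableChange.toIsogeny_some (curve p).twoIsogenyCodomain (twistChange hp2 s hs) h₁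
  have hu : (((twistChange hp2 s hs).map (algebraMap (ZMod p) (AlgebraicClosure (ZMod p)))).u : (AlgebraicClosure (ZMod p))) = sb := by
    simp [twistChange, VariableChange.map, hsb]
  have hu' : ((((twistChange hp2 s hs).map (algebraMap (ZMod p) (AlgebraicClosure (ZMod p)))).u⁻¹ : (AlgebraicClosure (ZMod p))ˣ) : (AlgebraicClosure (ZMod p))) = sb⁻¹ := by
    rw [Units.val_inv_eq_inv_val, hu]
  have hr : ((twistChange hp2 s hs).map (algebraMap (ZMod p) (AlgebraicClosure (ZMod p)))).r = 0 := by
    simp [twistChange, VariableChange.map]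
  have hsC : ((twistChange hp2 s hs).map (algebraMap (ZMod p) (AlgebraicClosure (ZMod p)))).s = 0 := by
    simp [twistChange, VariableChange.map]
  have ht : ((twistChange hp2 s hs).map (algebraMap (ZMod p) (AlgebraicClosure (ZMod p)))).t = 0 := by
    simp [twistChange, VariableChange.map]
  have etoX : ((twistChange hp2 s hs).map (algebraMap (ZMod p) (AlgebraicClosure (ZMod p)))).toX
      (((curve p).baseChange (AlgebraicClosure (ZMod p))).twoIsogenyX x) = -((x ^ 2 + 4 * x + 2) / x) / 2 := by
    rw [VariableChange.toX_def, hu', hr, hinv2, eX]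
    ring
  have etoY : ((twistChange hp2 s hs).map (algebraMap (ZMod p) (AlgebraicClosure (ZMod p)))).toY
      (((curve p).baseChange (AlgebraicClosure (ZMod p))).twoIsogenyX x) (((curve p).baseChange (AlgebraicClosure (ZMod p))).twoIsogenyY x y) =
        sb / 4 * (y * (x ^ 2 - 2) / x ^ 2) := by
    rw [VariableChange.toY_def, hu', hr, hsC, ht, hinv3, eY]
    ring
  obtain ⟨h', e₃⟩ := some_eq_some_of_eq _ etoX etoY
  refine ⟨(twistChange_smul hp2 s hs) ▸ h', ?_⟩
  rw [sqrtNegTwo, Isogeny.congrRight_apply, Isogeny.comp_apply, twoIsogeny_apply, e₁, e₂, e₃,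
    Affine.Point.congrEquiv_some]

/-- **`[√-2] ∘ [√-2] = [-2]` on `E(\overline{𝔽_p})`.** Off `E[2]` this is the pair of rational
identities `x_identity`, `y_identity` against the duplication formula; both sides being
homomorphisms, they agree everywhere (`AddMonoidHom.eq_of_eqOn_compl_finite`, `E[2]` finite).
[cite: SilvermanAdvancedTopics1994, II Prop. 2.3.1] -/
theorem sqrtNegTwo_comp_self (P : (curve p).geomPoints) :
    sqrtNegTwo hp2 s hs (sqrtNegTwo hp2 s hs P) = (-2 : ℤ) • P := by
  haveI := isElliptic_curve (p := p) hp2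
  set ψ := sqrtNegTwo hp2 s hs with hψ
  suffices h : ψ.toAddMonoidHom.comp ψ.toAddMonoidHom = (-2 : ℤ) • AddMonoidHom.id (curve p).geomPoints from
    congrArg (fun G : (curve p).geomPoints →+ (curve p).geomPoints ↦ G P) h
  refine AddMonoidHom.eq_of_eqOn_compl_finite (G := (curve p).geomPoints)
    (S := (geomTorsion (curve p) 2 : Set (curve p).geomPoints))
    (WeierstrassCurve.finite_geomTorsion (curve p) two_ne_zero) fun Q hQ ↦ ?_
  change ψ (ψ Q) = (-2 : ℤ) • Q
  have h2 := two_ne_zero_bar (p := p) hp2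
  -- `Q = (x, y)` with `y ≠ 0`
  rcases Q with _ | ⟨x, y, hxy⟩
  · exact absurd (zero_mem _) hQ
  have hcurve := curve_rel hxy
  have hy : y ≠ 0 := by
    intro hy0
    have h2P : (2 : ℤ) • (Affine.Point.some x y hxy : (curve p).geomPoints) = 0 := by
      rw [two_zsmul]
      exact Affine.Point.add_of_Y_eq (by rfl) (by rw [negY_of_isTwoTorsionNF, hy0, neg_zero])
    exact hQ ((Submodule.mem_torsionBy_iff (2 : ℤ) _).mpr h2P)
  obtain ⟨hx, hq⟩ := x_ne_zero_and hcurve hy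
  -- first application
  obtain ⟨h₁, e₁⟩ := sqrtNegTwo_some hp2 s hs hxy hx
  have hx₁ : -((x ^ 2 + 4 * x + 2) / x) / 2 ≠ 0 := by
    rw [neg_div, neg_ne_zero, div_ne_zero_iff, div_ne_zero_iff]
    exact ⟨⟨hq, hx⟩, h2⟩
  obtain ⟨h₂, e₂⟩ := sqrtNegTwo_some hp2 s hs h₁ hx₁
  -- doubling
  have hyneg : y ≠ ((curve p).baseChange (AlgebraicClosure (ZMod p))).toAffine.negY x y := by
    rw [negY_of_isTwoTorsionNF]
    intro h
    have : 2 * y = 0 := by linear_combination h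
    exact (mul_ne_zero h2 hy) this
  have ha₂ : ((curve p).baseChange (AlgebraicClosure (ZMod p))).a₂ = 4 := by
    simp only [WeierstrassCurve.baseChange, WeierstrassCurve.map_a₂, curve, map_ofNat]
  have ha₄ : ((curve p).baseChange (AlgebraicClosure (ZMod p))).a₄ = 2 := by
    simp only [WeierstrassCurve.baseChange, WeierstrassCurve.map_a₄, curve, map_ofNat]
  have hℓ : ((curve p).baseChange (AlgebraicClosure (ZMod p))).toAffine.slope x x y y = (3 * x ^ 2 + 2 * 4 * x + 2) / (2 * y) := by
    rw [slope_self_eq _ hyneg hy, ha₂, ha₄]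
  have edbl : (-2 : ℤ) • (Affine.Point.some x y hxy : (curve p).geomPoints) =
      -((Affine.Point.some x y hxy : (curve p).geomPoints) + .some x y hxy) := by
    rw [neg_smul, two_zsmul]
  have eadd : (Affine.Point.some x y hxy : ((curve p).baseChange (AlgebraicClosure (ZMod p))).toAffine.Point) + .some x y hxy =
      .some _ _ (Affine.nonsingular_add hxy hxy fun h ↦ hyneg h.2) :=
    Affine.Point.add_self_of_Y_ne hyneg
  -- compare coordinates
  have hsb2 : (algebraMap (ZMod p) (AlgebraicClosure (ZMod p)) s) ^ 2 = -2 := by rw [← map_pow, hs, map_neg, map_ofNat]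
  obtain ⟨h₃, e₃⟩ := some_eq_some_of_eq h₂
    (x' := ((curve p).baseChange (AlgebraicClosure (ZMod p))).toAffine.addX x x (((curve p).baseChange (AlgebraicClosure (ZMod p))).toAffine.slope x x y y))
    (y' := ((curve p).baseChange (AlgebraicClosure (ZMod p))).toAffine.negY
      (((curve p).baseChange (AlgebraicClosure (ZMod p))).toAffine.addX x x (((curve p).baseChange (AlgebraicClosure (ZMod p))).toAffine.slope x x y y))
      (((curve p).baseChange (AlgebraicClosure (ZMod p))).toAffine.addY x x y (((curve p).baseChange (AlgebraicClosure (ZMod p))).toAffine.slope x x y y)))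
    (by rw [addX_self_eq, hℓ, ha₂]; exact x_identity h2 hcurve hy)
    (by
      rw [negY_of_isTwoTorsionNF, addY_self_eq, neg_neg, addX_self_eq, hℓ, ha₂,
        ← y_identity h2 hcurve hy]
      have e4 : algebraMap (ZMod p) (AlgebraicClosure (ZMod p)) s / 4 * (algebraMap (ZMod p) (AlgebraicClosure (ZMod p)) s / 4 * (y * (x ^ 2 - 2) / x ^ 2) *
          ((-((x ^ 2 + 4 * x + 2) / x) / 2) ^ 2 - 2) / (-((x ^ 2 + 4 * x + 2) / x) / 2) ^ 2) =
          (algebraMap (ZMod p) (AlgebraicClosure (ZMod p)) s / 4) ^ 2 * (y * (x ^ 2 - 2) / x ^ 2 *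
            ((-((x ^ 2 + 4 * x + 2) / x) / 2) ^ 2 - 2) / (-((x ^ 2 + 4 * x + 2) / x) / 2) ^ 2) := by
        ring
      have h4 : (4 : (AlgebraicClosure (ZMod p))) ≠ 0 := by
        rw [show (4 : (AlgebraicClosure (ZMod p))) = 2 ^ 2 by norm_num]; exact pow_ne_zero _ h2
      have h8 : (8 : (AlgebraicClosure (ZMod p))) ≠ 0 := by
        rw [show (8 : (AlgebraicClosure (ZMod p))) = 2 ^ 3 by norm_num]; exact pow_ne_zero _ h2
      rw [e4, div_pow, hsb2]
      field_simp
      ring)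
  refine (congrArg ψ e₁).trans (e₂.trans (Eq.trans ?_ edbl.symm))
  change (_ : ((curve p).baseChange (AlgebraicClosure (ZMod p))).toAffine.Point) =
    -((Affine.Point.some x y hxy : ((curve p).baseChange (AlgebraicClosure (ZMod p))).toAffine.Point) + Affine.Point.some x y hxy)
  rw [eadd, Affine.Point.neg_some]
  exact e₃

include hp2 hs in
/-- **Deuring's theorem for `j = 8000`, split case.** For an odd prime `p` at which `-2` is a
square, `E : y² = x³ + 4x² + 2x` modulo `p` has a point of order `p` over `\overline{𝔽_p}`.
[cite: Lang1987, Ch. 13 §4 Thm. 12 (PDF pp. 140–141)] -/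
theorem exists_ne_zero_nsmul_eq_zero :
    ∃ P : (curve p).geomPoints, P ≠ 0 ∧ p • P = 0 := by
  haveI := isElliptic_curve (p := p) hp2
  refine WeierstrassCurve.Isogeny.exists_ne_zero_nsmul_eq_zero_of_comp_self_eq_smul p hp2
    (sqrtNegTwo hp2 s hs) (d := -2) (sqrtNegTwo_comp_self hp2 s hs) (by norm_num) ?_ ?_
  · rw [Int.dvd_neg]
    intro h
    have h' : (p : ℤ) ∣ ((2 : ℕ) : ℤ) := h
    rw [Int.natCast_dvd_natCast] at h'
    exact hp2 ((Nat.prime_dvd_prime_iff_eq (Fact.out : p.Prime) Nat.prime_two).mp h')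
  · refine ⟨s, ?_⟩
    rw [← pow_two, hs]
    push_cast
    ring

end DeuringSqrtTwo

end Literature.NumberTheory.EllipticCurves
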